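import Literature.NumberTheory.Transcendental.RoySmallValueStep4Glue
import HarnessLib

/-!
# Roy's small value estimate for `𝔾ₐ × 𝔾ₘ` — §7 Step 4 bookkeeping with the honest `log dist(α, A_γ)`

Topic `Literature/NumberTheory/Transcendental`. Part of the formalisation of the proof of Roy 2013,
Theorem 1.1 (named fact `roy2013_thm_1_1`, `RoySmallValueEstimates.lean`), seat B. Source: D. Roy,
*A small value estimate for `𝔾ₐ × 𝔾ₘ`*, Mathematika 59 (2013) 333–363 = arXiv:1301.0663, §7,
Step 4 (p. 19):

> `log|P*(α)| ≤ 3(D*)^β + max{T* log dist(α,(1:γ)), log dist(α,A_γ)}` [...] for any subset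
> `𝒮` of `𝒰`, we have `∑_{α∈𝒮} max{T* log dist(α,(1:γ)), log dist(α,A_γ)} ≥ −8(D*)^β deg(Z) − D* h(Z)`.

`RoySmallValueStep4Glue.step4_sum_max_ge` states this with Lean's `Real.log (q j)` (junk value
`0` at `q j = 0`). Since a point `α` may lie ON the curve `A_γ` (`dist(α, A_γ) = 0`, `log = −∞` in
the paper), the assembly uses instead an "honest" second coordinate `b_j` (any real with
`log q_j ≤ b_j` when `q_j > 0`, e.g. `b_j = log q_j` if `q_j > 0` and `T log p_j` otherwise, as in
`RoySmallValueStep2Distances`). This file proves the same chain for such `b_j` and `q_j ≥ 0`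
(`step4_sum_max_ge'`, with the per-point step `log_le_log_four_mul_add_max'`). Everything is
proved; no definitions, no named facts.

## References

* [Roy2013] D. Roy, *A small value estimate for 𝔾ₐ × 𝔾ₘ*, Mathematika 59 (2013), 333–363
  (arXiv:1301.0663), §7, Step 4.
-/

noncomputable section

open Finset

namespace Literature.NumberTheory.Transcendental

namespace Roy2013

variable {ι : Type*}

/-- Per point: for `x > 0`, `x ≤ 2M(p^T + q)` with `M, p > 0`, `q ≥ 0` and `b ≥ log q` if `q > 0`:
`log x ≤ log(4M) + max{T log p, b}`. [cite: Roy2013, §7, Step 4] -/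
theorem log_le_log_four_mul_add_max' {x M p q b : ℝ} {T : ℕ} (hx : 0 < x) (hM : 0 < M)
    (hp : 0 < p) (hq : 0 ≤ q) (hb : 0 < q → Real.log q ≤ b) (h : x ≤ 2 * (M * (p ^ T + q))) :
    Real.log x ≤ Real.log (4 * M) + max (T * Real.log p) b := by
  rcases hq.lt_or_eq with hqpos | hq0
  · have h1 := log_le_log_four_mul_add_max hx hM hp hqpos h
    have h2 : max (T * Real.log p) (Real.log q) ≤ max (T * Real.log p) b :=
      max_le_max le_rfl (hb hqpos)
    linarith
  · -- `q = 0`: `x ≤ 2M p^T`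
    rw [← hq0, add_zero] at h
    have h1 : Real.log x ≤ Real.log (2 * (M * p ^ T)) := Real.log_le_log hx h
    rw [show 2 * (M * p ^ T) = (2 * M) * p ^ T by ring,
      Real.log_mul (by positivity) (pow_pos hp T).ne', Real.log_pow] at h1
    have h2 : Real.log (2 * M) ≤ Real.log (4 * M) := Real.log_le_log (by positivity) (by linarith)
    have h3 : (T : ℝ) * Real.log p ≤ max (T * Real.log p) b := le_max_left _ _
    linarith

/-- **Roy 2013, §7, Step 4, assembled (honest version)**: as `step4_sum_max_ge` with the second
coordinate of the `max` an arbitrary `b_j ≥ log q_j` (when `q_j > 0`) and `q_j ≥ 0` allowed.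
[cite: Roy2013, §7, Step 4] -/
theorem step4_sum_max_ge' {O S : Finset ι} (hSO : S ⊆ O) (y p q b : ι → ℝ) {Dh C₂ c B M : ℝ}
    (T : ℕ) (hy : ∀ j ∈ O, 0 < y j) (hL : 0 ≤ Dh + ∑ j ∈ O, Real.log (y j))
    (hC : ∀ j ∈ O, Real.log (y j) ≤ C₂) (hC₂ : 0 ≤ C₂) (hcB : 0 < c * B) (hM : 0 < M)
    (hp : ∀ j ∈ S, 0 < p j) (hq : ∀ j ∈ S, 0 ≤ q j) (hb : ∀ j ∈ S, 0 < q j → Real.log (q j) ≤ b j)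
    (hval : ∀ j ∈ S, y j ≤ c * B + M * (p j ^ T + q j))
    (hbig : Real.log (2 * (c * B)) < -(Dh + #O * C₂)) :
    -(Dh + #O * C₂ + #S * Real.log (4 * M)) ≤ ∑ j ∈ S, max (T * Real.log (p j)) (b j) := by
  have h71 : -(Dh + #O * C₂) ≤ ∑ j ∈ O, min 0 (Real.log (y j)) :=
    sum_min_zero_ge O (fun j => Real.log (y j)) hC₂ hL hC
  have hpt : ∀ j ∈ S, Real.log (y j) - Real.log (4 * M) ≤ max (T * Real.log (p j)) (b j) := by
    intro j hj
    have hjO := hSO hj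
    have hlow : -(Dh + #O * C₂) ≤ Real.log (y j) :=
      h71.trans (sum_min_zero_le_self (fun i => Real.log (y i)) hjO)
    have h2 : 2 * (c * B) ≤ y j := by
      have : Real.log (2 * (c * B)) < Real.log (y j) := lt_of_lt_of_le hbig hlow
      exact ((Real.log_lt_log_iff (by linarith) (hy j hjO)).mp this).le
    have h3 := le_two_mul_of_le_add (hval j hj) h2
    have h4 := log_le_log_four_mul_add_max' (hy j hjO) hM (hp j hj) (hq j hj) (hb j hj) h3
    linarith
  exact sum_max_ge_of_pointwise hSO (fun j => Real.log (y j))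
    (fun j => max (T * Real.log (p j)) (b j)) h71 hpt

end Roy2013

end Literature.NumberTheory.Transcendental
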